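import Literature.Geometry.Lorentzian.BogovskiiH1Bound
import Mathlib.Analysis.MeanInequalitiesPow
import HarnessLib

/-!
# `L²`-boundedness of the tensor `T_η F` on densities supported in a ball (order-`0` part of (T3))

(trunk G08 = T-LORENTZ; family `gr`; namespace `Literature.Geometry.Lorentzian.MaoOhTao`.)

Mao–Oh–Tao (arXiv:2308.13031), Lemma 2.3 (T3): `T(χ_Ω ·) : H^{s'} → H^{s'+1}`.  The tensor (corrected sign)
`(T_η F)^{ij} = ½(SV^i_j + SV^j_i) + ½ Σ_m ∂_m(SK^{im}_j + SK^{jm}_i) − Σ_k ∂_k SK^{ij}_k` (`bogovskiiT`) is a sum of eleven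
terms each of which is `L²(B̄_ρ) → L²` bounded: the `SV` terms by `BogovskiiVectorL2Bound.lean`, the `∂S` terms by
`BogovskiiH1Bound.lean`.  Hence (`exists_l2Const_bogovskiiT`):

  `∫ |(T_η F)^{ij}|² ≤ C Σ_k ∫ |F_k|²`  for `F ∈ C¹_c(B̄_ρ)³`.

(The gain of one derivative in (T3) requires the `L²` bound for `∂SV` and `∂²S`, Calderón–Zygmund operators — not treated.)

## References

* Y. Mao, S.-J. Oh, T. Tao, arXiv:2308.13031 (2023), Lemma 2.3 (T3), pp. 8–9 (key `MaoOhTao2023`).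
-/

noncomputable section

open scoped RealInnerProductSpace Topology ENNReal
open Filter MeasureTheory Set Metric Function

namespace Literature.Geometry.Lorentzian

namespace MaoOhTao

variable {η : E3 → ℝ} {R : ℝ}

/-- `‖a + b‖ₑ² ≤ 2(‖a‖ₑ² + ‖b‖ₑ²)` in `ℝ≥0∞` (real exponent `2`). [folklore] -/
theorem enorm_add_sq_le (a b : ℝ≥0∞) : (a + b) ^ (2 : ℝ) ≤ 2 * (a ^ (2 : ℝ) + b ^ (2 : ℝ)) := by
  have h := ENNReal.rpow_add_le_mul_rpow_add_rpow a b (p := 2) (by norm_num)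
  norm_num at h ⊢
  exact h

/-- `(Σ_{k<3} a_k)² ≤ 3 Σ a_k²` in `ℝ≥0∞`. [folklore] -/
theorem enorm_sum_three_sq_le (a : Fin 3 → ℝ≥0∞) : (∑ k, a k) ^ (2 : ℝ) ≤ 3 * ∑ k, a k ^ (2 : ℝ) := by
  have h := ENNReal.rpow_sum_le_const_mul_sum_rpow Finset.univ a (p := 2) (by norm_num)
  norm_num at h ⊢
  exact h

/-- **`L²`-boundedness of `T_η` on `L²(B̄_ρ)`** (order-`0` part of (T3)): for `η ∈ C¹_c` vanishing off `B̄_R` and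
`R + ρ ≥ 0` there is `C < ∞` with `∫ |(T_η F)^{ij}|² ≤ C Σ_k ∫ |F_k|²` for all `F ∈ C¹_c` supported in `B̄_ρ`.
[cite: MaoOhTao2023, Lemma 2.3 (T3)] -/
theorem exists_l2Const_bogovskiiT (hη : ContDiff ℝ 1 η) (hR : ∀ z : E3, R < ‖z‖ → η z = 0) {ρ : ℝ}
    (hRρ : 0 ≤ R + ρ) :
    ∃ C : ℝ≥0∞, C < ⊤ ∧ ∀ (F : Fin 3 → E3 → ℝ), (∀ k, ContDiff ℝ 1 (F k)) → (∀ k, HasCompactSupport (F k)) →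
      (∀ k y, F k y ≠ 0 → ‖y‖ ≤ ρ) → ∀ i j : Fin 3,
        ∫⁻ x : E3, ‖bogovskiiT η F i j x‖ₑ ^ (2 : ℝ) ≤ C * ∑ k, ∫⁻ y : E3, ‖F k y‖ₑ ^ (2 : ℝ) := by
  obtain ⟨CV, hCV, hV⟩ := exists_l2Const_bogovskiiSV hη.continuous hR ρ
  obtain ⟨CH, hCH, hH⟩ := exists_h1Const_bogovskiiS hη hR hRρ
  refine ⟨16 * CV + 162 * CH, ?_, fun F hF hFc hFρ i j ↦ ?_⟩
  · exact ENNReal.add_lt_top.2 ⟨ENNReal.mul_lt_top (by norm_num) hCV, ENNReal.mul_lt_top (by norm_num) hCH⟩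
  set SF : ℝ≥0∞ := ∑ k, ∫⁻ y : E3, ‖F k y‖ₑ ^ (2 : ℝ) with hSF
  have hFk_le : ∀ k, ∫⁻ y : E3, ‖F k y‖ₑ ^ (2 : ℝ) ≤ SF := fun k ↦
    Finset.single_le_sum (f := fun k ↦ ∫⁻ y : E3, ‖F k y‖ₑ ^ (2 : ℝ)) (fun _ _ ↦ bot_le) (Finset.mem_univ k)
  -- the eleven building blocks and their bounds
  have hSV : ∀ k a, ∫⁻ x, ‖bogovskiiSV η (F k) a x‖ₑ ^ (2 : ℝ) ≤ CV * SF := fun k a ↦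
    (hV (F k) (hF k).continuous (hFρ k) a).trans (mul_le_mul' le_rfl (hFk_le k))
  have hDS : ∀ k a b m, ∫⁻ x, ‖pd m (bogovskiiS η (F k) a b) x‖ₑ ^ (2 : ℝ) ≤ CH * SF := fun k a b m ↦
    (hH (F k) (hF k) (hFc k) (hFρ k) a b m).trans (mul_le_mul' le_rfl (hFk_le k))
  -- measurability of the blocks
  have mSV : ∀ k a, Measurable fun x ↦ ‖bogovskiiSV η (F k) a x‖ₑ ^ (2 : ℝ) := fun k a ↦
    ((contDiff_one_bogovskiiSV hη hR (hF k) (hFc k) a).continuous.measurable.enorm.pow_const _)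
  have mDS : ∀ k a b m, Measurable fun x ↦ ‖pd m (bogovskiiS η (F k) a b) x‖ₑ ^ (2 : ℝ) := fun k a b m ↦
    ((contDiff_pd (n := 0) (contDiff_one_bogovskiiS hη hR (hF k) (hFc k) a b) m).continuous.measurable.enorm.pow_const
      _)
  -- pointwise: `‖T‖² ≤ 4‖A‖² + 4‖B‖² + 2‖C‖²` etc.
  have hpt : ∀ x, ‖bogovskiiT η F i j x‖ₑ ^ (2 : ℝ) ≤
      8 * (‖bogovskiiSV η (F j) i x‖ₑ ^ (2 : ℝ) + ‖bogovskiiSV η (F i) j x‖ₑ ^ (2 : ℝ)) +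
      24 * ∑ m, (‖pd m (bogovskiiS η (F j) i m) x‖ₑ ^ (2 : ℝ) + ‖pd m (bogovskiiS η (F i) j m) x‖ₑ ^ (2 : ℝ)) +
      6 * ∑ k, ‖pd k (bogovskiiS η (F k) i j) x‖ₑ ^ (2 : ℝ) := by
    intro x
    set u := bogovskiiSV η (F j) i x
    set v := bogovskiiSV η (F i) j x
    set P : Fin 3 → ℝ := fun m ↦ pd m (bogovskiiS η (F j) i m) x
    set Q : Fin 3 → ℝ := fun m ↦ pd m (bogovskiiS η (F i) j m) x
    set Rk : Fin 3 → ℝ := fun k ↦ pd k (bogovskiiS η (F k) i j) x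
    have hT : bogovskiiT η F i j x = (1 / 2 : ℝ) * (u + v) + (1 / 2 : ℝ) * (∑ m, (P m + Q m)) - ∑ k, Rk k := rfl
    -- triangle inequalities in `ℝ≥0∞`
    have hA : ‖(1 / 2 : ℝ) * (u + v)‖ₑ ≤ ‖u‖ₑ + ‖v‖ₑ := by
      rw [enorm_mul]
      have h12 : ‖(1 / 2 : ℝ)‖ₑ ≤ 1 := by
        rw [Real.enorm_eq_ofReal (by norm_num)]; exact ENNReal.ofReal_le_one.2 (by norm_num)
      calc ‖(1 / 2 : ℝ)‖ₑ * ‖u + v‖ₑ ≤ 1 * ‖u + v‖ₑ := mul_le_mul' h12 le_rfl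
        _ = ‖u + v‖ₑ := one_mul _
        _ ≤ ‖u‖ₑ + ‖v‖ₑ := enorm_add_le _ _
    have hB : ‖(1 / 2 : ℝ) * (∑ m, (P m + Q m))‖ₑ ≤ ∑ m, (‖P m‖ₑ + ‖Q m‖ₑ) := by
      rw [enorm_mul]
      have h12 : ‖(1 / 2 : ℝ)‖ₑ ≤ 1 := by
        rw [Real.enorm_eq_ofReal (by norm_num)]; exact ENNReal.ofReal_le_one.2 (by norm_num)
      calc ‖(1 / 2 : ℝ)‖ₑ * ‖∑ m, (P m + Q m)‖ₑ ≤ 1 * ‖∑ m, (P m + Q m)‖ₑ := mul_le_mul' h12 le_rfl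
        _ = ‖∑ m, (P m + Q m)‖ₑ := one_mul _
        _ ≤ ∑ m, ‖P m + Q m‖ₑ := enorm_sum_le _ _
        _ ≤ ∑ m, (‖P m‖ₑ + ‖Q m‖ₑ) := Finset.sum_le_sum fun m _ ↦ enorm_add_le _ _
    have hC : ‖∑ k, Rk k‖ₑ ≤ ∑ k, ‖Rk k‖ₑ := enorm_sum_le _ _
    have h1 : ‖bogovskiiT η F i j x‖ₑ ≤ (‖u‖ₑ + ‖v‖ₑ) + ∑ m, (‖P m‖ₑ + ‖Q m‖ₑ) + ∑ k, ‖Rk k‖ₑ := by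
      rw [hT]
      calc ‖(1 / 2 : ℝ) * (u + v) + (1 / 2 : ℝ) * (∑ m, (P m + Q m)) - ∑ k, Rk k‖ₑ
          ≤ ‖(1 / 2 : ℝ) * (u + v) + (1 / 2 : ℝ) * (∑ m, (P m + Q m))‖ₑ + ‖∑ k, Rk k‖ₑ := enorm_sub_le
        _ ≤ (‖(1 / 2 : ℝ) * (u + v)‖ₑ + ‖(1 / 2 : ℝ) * (∑ m, (P m + Q m))‖ₑ) + ‖∑ k, Rk k‖ₑ :=
            add_le_add (enorm_add_le _ _) le_rfl
        _ ≤ (‖u‖ₑ + ‖v‖ₑ) + ∑ m, (‖P m‖ₑ + ‖Q m‖ₑ) + ∑ k, ‖Rk k‖ₑ := add_le_add (add_le_add hA hB) hC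
    -- square
    calc ‖bogovskiiT η F i j x‖ₑ ^ (2 : ℝ)
        ≤ ((‖u‖ₑ + ‖v‖ₑ) + ∑ m, (‖P m‖ₑ + ‖Q m‖ₑ) + ∑ k, ‖Rk k‖ₑ) ^ (2 : ℝ) := ENNReal.rpow_le_rpow h1 (by norm_num)
      _ ≤ 2 * (((‖u‖ₑ + ‖v‖ₑ) + ∑ m, (‖P m‖ₑ + ‖Q m‖ₑ)) ^ (2 : ℝ) + (∑ k, ‖Rk k‖ₑ) ^ (2 : ℝ)) := enorm_add_sq_le _ _
      _ ≤ 2 * (2 * ((‖u‖ₑ + ‖v‖ₑ) ^ (2 : ℝ) + (∑ m, (‖P m‖ₑ + ‖Q m‖ₑ)) ^ (2 : ℝ)) + 3 * ∑ k, ‖Rk k‖ₑ ^ (2 : ℝ)) := by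
          gcongr
          · exact enorm_add_sq_le _ _
          · exact enorm_sum_three_sq_le _
      _ ≤ 2 * (2 * (2 * (‖u‖ₑ ^ (2 : ℝ) + ‖v‖ₑ ^ (2 : ℝ)) + 3 * ∑ m, (‖P m‖ₑ + ‖Q m‖ₑ) ^ (2 : ℝ)) +
            3 * ∑ k, ‖Rk k‖ₑ ^ (2 : ℝ)) := by
          gcongr
          · exact enorm_add_sq_le _ _
          · exact enorm_sum_three_sq_le _
      _ ≤ 2 * (2 * (2 * (‖u‖ₑ ^ (2 : ℝ) + ‖v‖ₑ ^ (2 : ℝ)) + 3 * ∑ m, 2 * (‖P m‖ₑ ^ (2 : ℝ) + ‖Q m‖ₑ ^ (2 : ℝ))) +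
            3 * ∑ k, ‖Rk k‖ₑ ^ (2 : ℝ)) := by
          gcongr with m _
          exact enorm_add_sq_le _ _
      _ = 8 * (‖u‖ₑ ^ (2 : ℝ) + ‖v‖ₑ ^ (2 : ℝ)) + 24 * ∑ m, (‖P m‖ₑ ^ (2 : ℝ) + ‖Q m‖ₑ ^ (2 : ℝ)) +
            6 * ∑ k, ‖Rk k‖ₑ ^ (2 : ℝ) := by
          rw [← Finset.mul_sum]
          ring
  -- integrate
  calc ∫⁻ x, ‖bogovskiiT η F i j x‖ₑ ^ (2 : ℝ)
      ≤ ∫⁻ x, (8 * (‖bogovskiiSV η (F j) i x‖ₑ ^ (2 : ℝ) + ‖bogovskiiSV η (F i) j x‖ₑ ^ (2 : ℝ)) +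
          24 * ∑ m, (‖pd m (bogovskiiS η (F j) i m) x‖ₑ ^ (2 : ℝ) + ‖pd m (bogovskiiS η (F i) j m) x‖ₑ ^ (2 : ℝ)) +
          6 * ∑ k, ‖pd k (bogovskiiS η (F k) i j) x‖ₑ ^ (2 : ℝ)) := lintegral_mono hpt
    _ = 8 * ((∫⁻ x, ‖bogovskiiSV η (F j) i x‖ₑ ^ (2 : ℝ)) + ∫⁻ x, ‖bogovskiiSV η (F i) j x‖ₑ ^ (2 : ℝ)) +
          24 * ∑ m, ((∫⁻ x, ‖pd m (bogovskiiS η (F j) i m) x‖ₑ ^ (2 : ℝ)) +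
            ∫⁻ x, ‖pd m (bogovskiiS η (F i) j m) x‖ₑ ^ (2 : ℝ)) +
          6 * ∑ k, ∫⁻ x, ‖pd k (bogovskiiS η (F k) i j) x‖ₑ ^ (2 : ℝ) := by
        have mA : Measurable fun x ↦ ‖bogovskiiSV η (F j) i x‖ₑ ^ (2 : ℝ) + ‖bogovskiiSV η (F i) j x‖ₑ ^ (2 : ℝ) :=
          (mSV j i).add (mSV i j)
        have mBm : ∀ m, Measurable fun x ↦ ‖pd m (bogovskiiS η (F j) i m) x‖ₑ ^ (2 : ℝ) +
            ‖pd m (bogovskiiS η (F i) j m) x‖ₑ ^ (2 : ℝ) := fun m ↦ (mDS j i m m).add (mDS i j m m)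
        have mB : Measurable fun x ↦ ∑ m, (‖pd m (bogovskiiS η (F j) i m) x‖ₑ ^ (2 : ℝ) +
            ‖pd m (bogovskiiS η (F i) j m) x‖ₑ ^ (2 : ℝ)) := Finset.measurable_sum _ fun m _ ↦ mBm m
        have mC : Measurable fun x ↦ ∑ k, ‖pd k (bogovskiiS η (F k) i j) x‖ₑ ^ (2 : ℝ) :=
          Finset.measurable_sum _ fun k _ ↦ mDS k i j k
        have m1 : Measurable fun x ↦ 8 * (‖bogovskiiSV η (F j) i x‖ₑ ^ (2 : ℝ) + ‖bogovskiiSV η (F i) j x‖ₑ ^ (2 : ℝ)) :=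
          mA.const_mul _
        have m12 : Measurable fun x ↦ 8 * (‖bogovskiiSV η (F j) i x‖ₑ ^ (2 : ℝ) + ‖bogovskiiSV η (F i) j x‖ₑ ^ (2 : ℝ)) +
            24 * ∑ m, (‖pd m (bogovskiiS η (F j) i m) x‖ₑ ^ (2 : ℝ) + ‖pd m (bogovskiiS η (F i) j m) x‖ₑ ^ (2 : ℝ)) :=
          m1.add (mB.const_mul _)
        rw [lintegral_add_left m12, lintegral_add_left m1, lintegral_const_mul _ mA, lintegral_add_left (mSV j i),
          lintegral_const_mul _ mB, lintegral_finsetSum _ (fun m _ ↦ mBm m), lintegral_const_mul _ mC,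
          lintegral_finsetSum _ (fun k _ ↦ mDS k i j k)]
        simp only [lintegral_add_left (mDS j i _ _)]
    _ ≤ 8 * (CV * SF + CV * SF) + 24 * ∑ _m : Fin 3, (CH * SF + CH * SF) + 6 * ∑ _k : Fin 3, CH * SF := by
        gcongr with m _ k _
        · exact hSV j i
        · exact hSV i j
        · exact hDS j i m m
        · exact hDS i j m m
        · exact hDS k i j k
    _ = (16 * CV + 162 * CH) * SF := by
        simp only [Finset.sum_const, Finset.card_univ, Fintype.card_fin, nsmul_eq_mul, Nat.cast_ofNat]
        ring

end MaoOhTao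

end Literature.Geometry.Lorentzian

end
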